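import Mathlib.Analysis.SpecialFunctions.Exponential
import HarnessLib

/-!
# K1L_D `stub_D1_V0thg` (stmt-AnomalousDissipation-27980), R3′ lane — the crushing factor is `O(ν)`: `exp(−c/r) ≤ (6/c³)·r³` (`r = ν^{1/3}`)

Helper file of route `SolenoidalFractalHomogenisation` (`--supports stmt-AnomalousDissipation-27980 --as helper`; one-generation hand
`leafhand-ad-solenoidalfractalh-1` g0, road E-c; Mathlib only).  The full-slot crush `Sideband.ladder_crush_slot_nu(_exists)` gives, across a quasi-statically
stretched slot `τᵢ = τᵢ⁰/r³` (`ν = r³`), the factor `exp(−ccr·r²·τᵢ/2) = exp(−(ccr τᵢ⁰/2)/r)`; the (V_θg) assembly (R3′-4: defect `≤ C_R ν^{σ_R} + L_Ψ θ`,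
`σ_R = 1`) only needs that this is `O(ν)`.  `exp_neg_div_le_cube`: `exp(−c/r) ≤ (6/c³)·r³` for `c, r > 0` (from `x³/3! ≤ eˣ`);
`crushFactor_le_linear`: `exp(−c·r²·((τ⁰/r³)/2)) ≤ (48/(cτ⁰)³)·r³`.  No definitions, no sorry.  NOT a proof of `stub_D1_V0thg`, of K1L_D or of AD;
rung F-D1.A0 infrastructure.
-/

set_option linter.dupNamespace false -- single-conjunct summit: `Summit.AnomalousDissipation.AnomalousDissipation.…` is the mandated namespace

namespace Summit.AnomalousDissipation.AnomalousDissipation.Theorems.SolenoidalFractalHomogenisation.LagrangianStep.Sideband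

/-- **Exponential beats cubic**: `exp(−c/r) ≤ (6/c³)·r³` for `c, r > 0` (`(c/r)³/3! ≤ e^{c/r}`). [folklore] -/
theorem exp_neg_div_le_cube {c r : ℝ} (hc : 0 < c) (hr : 0 < r) : Real.exp (-(c / r)) ≤ 6 / c ^ 3 * r ^ 3 := by
  have hx : 0 ≤ c / r := by positivity
  have h3 : (c / r) ^ 3 / (Nat.factorial 3) ≤ Real.exp (c / r) := Real.pow_div_factorial_le_exp (c / r) hx 3
  have hfact : (Nat.factorial 3 : ℝ) = 6 := by norm_num [Nat.factorial]
  rw [hfact] at h3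
  have hpos : 0 < (c / r) ^ 3 / 6 := by positivity
  rw [Real.exp_neg]
  calc (Real.exp (c / r))⁻¹ ≤ ((c / r) ^ 3 / 6)⁻¹ := inv_anti₀ hpos h3
    _ = 6 / c ^ 3 * r ^ 3 := by field_simp

/-- **The crushing factor across a stretched slot is `O(ν)`**: with `ν = r³` and slot duration `τ = τ⁰/r³`,
`exp(−c·r²·(τ/2)) = exp(−(cτ⁰/2)/r) ≤ (48/(cτ⁰)³)·r³ = (48/(cτ⁰)³)·ν`. [folklore] -/
theorem crushFactor_le_linear {c τ₀ r : ℝ} (hc : 0 < c) (hτ₀ : 0 < τ₀) (hr : 0 < r) :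
    Real.exp (-(c * r ^ 2 * (τ₀ / r ^ 3 / 2))) ≤ 48 / (c * τ₀) ^ 3 * r ^ 3 := by
  have e : c * r ^ 2 * (τ₀ / r ^ 3 / 2) = (c * τ₀ / 2) / r := by
    field_simp
  rw [e]
  calc Real.exp (-(c * τ₀ / 2 / r)) ≤ 6 / (c * τ₀ / 2) ^ 3 * r ^ 3 := exp_neg_div_le_cube (by positivity) hr
    _ = 48 / (c * τ₀) ^ 3 * r ^ 3 := by
        congr 1
        field_simp
        ring

end Summit.AnomalousDissipation.AnomalousDissipation.Theorems.SolenoidalFractalHomogenisation.LagrangianStep.Sideband
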